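import Summits.BirchSwinnertonDyer.BirchSwinnertonDyer.Theorems.SylvesterTwoHeegnerIndexUpperOffV0ResInjective
import Summits.BirchSwinnertonDyer.BirchSwinnertonDyer.Theorems.SylvesterTwoHeegnerIndexFrameConstants
import HarnessLib

/-!
# K7t crux `UpperOffV0HSY` (item 19581): the `H¹`-restriction injectivity at `2^M` over the fields
# of the Kolyvagin argument — `ℚ` and the quadratic (Heegner) fields — for both curves of HSY's pair

Route `SylvesterTwoHeegnerIndex` (cell bsd-cm, rung K7t).  Corollaries of
`SylvesterTwoUpper.res_injective_divisionField_twoPow_of_mordell` (p444008: for an `F`-model `B` of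
`y² = x³ − c` with `∛c ∉ F`, `res : H¹(F, E[2^M]) → H¹(F(E[2^M]), E[2^M])` is injective) in which
the hypothesis «`x³ = c` has no root in `F`» is DISCHARGED:

* §1 the partner constant: `3888p⁴ = 432·(3p²)²` is not a rational cube (`2`-adic valuation `4`),
  and a rational non-cube stays a non-cube in every quadratic field (norm argument, as in k7t-c2 g0's
  `SylvesterTwoFrame.cube_ne_432_mul_sq_of_finrank_eq_two`);
* §2 over `ℚ`: for EVERY `ℚ`-model of `E_p = cubeSumCurve p` and of the partner
  `E_{3p²} = cubeSumCurve (3p²)` (`p` an odd prime) and every `M ≥ 1`, unconditionally;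
* §3 over every QUADRATIC number field `K` (the imaginary quadratic Heegner fields of the cruxes):
  the same for every `K`-model of the base change of either curve.

These are the fields `F ∈ {ℚ, K}` at which McCallum's Prop. 2.1 is invoked in the Kolyvagin
descent (McCallum 1991 §§2–5); the ring class fields `K_n` are not treated here.
NOT the crux: the sharp 2-adic Kolyvagin bound off 𝒱₀ stays open (B14 = O12 open as a class).
-/

noncomputable section

open scoped Classical
open Field WeierstrassCurve Literature.NumberTheory.EllipticCurves
  Literature.NumberTheory.EllipticCurves.HuShuYin2019
  Literature.NumberTheory.GaloisRepresentations

set_option autoImplicit false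
set_option linter.dupNamespace false

namespace Summit.BirchSwinnertonDyer.BirchSwinnertonDyer.Theorems.SylvesterTwoUpper

universe u

/-! ## §1 Cube roots: the partner constant `3888p⁴` and quadratic fields -/

section Cubes

variable {p : ℕ}

/-- **`3888p⁴ = 432·(3p²)²` is not a rational cube** (`p` an odd prime): `v₂(3888p⁴) = 4` is not a
multiple of `3`. [folklore] -/
theorem rat_cube_ne_3888_mul_pow_four (hp : p.Prime) (hp2 : p ≠ 2) (q : ℚ) :
    q ^ 3 ≠ 432 * (3 * (p : ℚ) ^ 2) ^ 2 := by
  intro h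
  haveI : Fact (Nat.Prime 2) := ⟨Nat.prime_two⟩
  have hp0 : (p : ℚ) ≠ 0 := Nat.cast_ne_zero.mpr hp.ne_zero
  have hrhs : (432 * (3 * (p : ℚ) ^ 2) ^ 2) = (3888 : ℚ) * (p : ℚ) ^ 4 := by ring
  have hv := congrArg (padicValRat 2) h
  rw [hrhs, padicValRat.pow q, padicValRat.mul (by norm_num) (pow_ne_zero 4 hp0),
    padicValRat.pow (p : ℚ)] at hv
  have h3888 : padicValRat 2 (3888 : ℚ) = 4 := by
    rw [show (3888 : ℚ) = ((2 ^ 4 * 243 : ℕ) : ℚ) by norm_num, padicValRat.of_nat,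
      padicValNat.mul (by norm_num) (by norm_num), padicValNat.prime_pow,
      padicValNat.eq_zero_of_not_dvd (by norm_num)]
    norm_num
  have hpv : padicValRat 2 (p : ℚ) = 0 := by
    rw [padicValRat.of_nat, Nat.cast_eq_zero]
    exact padicValNat.eq_zero_of_not_dvd fun h2 =>
      hp2 ((Nat.prime_dvd_prime_iff_eq Nat.prime_two hp).mp h2).symm
  rw [h3888, hpv] at hv
  omega

/-- **A rational non-cube is a non-cube in every quadratic number field** (norm argument: if
`x³ = m` in `K` then `N(x)³ = m²`, so `(m/N(x))³ = m` in `ℚ`). [folklore] -/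
theorem cube_ne_algebraMap_of_finrank_eq_two (K : Type*) [Field K] [NumberField K]
    (hK : Module.finrank ℚ K = 2) {m : ℚ} (hm0 : m ≠ 0) (hm : ∀ q : ℚ, q ^ 3 ≠ m) (x : K) :
    x ^ 3 ≠ algebraMap ℚ K m := by
  intro hx
  have hN : (Algebra.norm ℚ x) ^ 3 = m ^ 2 := by
    rw [← map_pow, hx, Algebra.norm_algebraMap, hK]
  set n : ℚ := Algebra.norm ℚ x with hn
  have hn0 : n ≠ 0 := by
    intro h0
    rw [h0] at hN
    exact hm0 (pow_eq_zero_iff (n := 2) (by norm_num) |>.mp (by simpa using hN.symm))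
  apply hm (m / n)
  rw [div_pow, hN]
  field_simp

/-- `3888p⁴` is not a cube in a quadratic number field. [folklore] -/
theorem cube_ne_3888_mul_pow_four_of_finrank_eq_two (K : Type*) [Field K] [NumberField K]
    (hK : Module.finrank ℚ K = 2) (hp : p.Prime) (hp2 : p ≠ 2) (x : K) :
    x ^ 3 ≠ algebraMap ℚ K (432 * (3 * (p : ℚ) ^ 2) ^ 2) :=
  cube_ne_algebraMap_of_finrank_eq_two K hK
    (mul_ne_zero (by norm_num) (pow_ne_zero 2 (mul_ne_zero (by norm_num)
      (pow_ne_zero 2 (Nat.cast_ne_zero.mpr hp.ne_zero)))))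
    (rat_cube_ne_3888_mul_pow_four hp hp2) x

end Cubes

/-! ## §2 Over `ℚ`: every `ℚ`-model of `E_p` and of `E_{3p²}` -/

section Rat

/-- **`H¹(ℚ, E[2^M]) → H¹(ℚ(E[2^M]), E[2^M])` is injective for every `ℚ`-model of
`cubeSumCurve n = (y² = x³ − 432n²)` with `432n²` not a rational cube** (`M ≥ 1`). [folklore] -/
theorem res_injective_divisionField_twoPow_rat_of_cube_ne {n : ℚ} (hn : ∀ q : ℚ, q ^ 3 ≠ 432 * n ^ 2)
    (B : WeierstrassCurve ℚ) [B.IsElliptic] (hB : ∃ C : VariableChange ℚ, C • B = cubeSumCurve n)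
    {M : ℕ} (hM : 1 ≤ M) :
    Function.Injective (galoisCohomology.res (B.torsionGaloisModule ((2 ^ M : ℕ) : ℤ))
      (B.divisionField (2 ^ M)) 1) := by
  obtain ⟨C, hCB⟩ := hB
  exact res_injective_divisionField_twoPow_of_mordell hn B (C := C)
    (by rw [hCB, cubeSumCurve]; congr 1; ring) hM

/-- **McCallum's Prop. 2.1 at `p = 2` over `ℚ` for `E_p`**: for `p` an odd prime, every `ℚ`-model `B`
of `E_p : y² = x³ − 432p²` and every `M ≥ 1`, `res : H¹(ℚ, E_p[2^M]) → H¹(ℚ(E_p[2^M]), E_p[2^M])`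
is injective — unconditionally (`432p²` is not a rational cube, k7t-c2 g0 / k7t-c3).
[cite: McCallumLMS1991, Prop. 2.1] -/
theorem res_injective_divisionField_twoPow_rat {p : ℕ} (hp : p.Prime) (hp2 : p ≠ 2)
    (B : WeierstrassCurve ℚ) [B.IsElliptic]
    (hB : ∃ C : VariableChange ℚ, C • B = cubeSumCurve (p : ℚ)) {M : ℕ} (hM : 1 ≤ M) :
    Function.Injective (galoisCohomology.res (B.torsionGaloisModule ((2 ^ M : ℕ) : ℤ))
      (B.divisionField (2 ^ M)) 1) :=
  res_injective_divisionField_twoPow_rat_of_cube_ne (SylvesterTwoFrame.rat_cube_ne_432_mul_sq hp hp2)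
    B hB hM

/-- **The same for the partner `E_{3p²} : y² = x³ − 3888p⁴`** (`cubeSumCurve (3p²)`), every
`ℚ`-model, every `M ≥ 1`. [cite: McCallumLMS1991, Prop. 2.1] -/
theorem res_injective_divisionField_twoPow_rat_partner {p : ℕ} (hp : p.Prime) (hp2 : p ≠ 2)
    (A : WeierstrassCurve ℚ) [A.IsElliptic]
    (hA : ∃ C : VariableChange ℚ, C • A = cubeSumCurve (3 * (p : ℚ) ^ 2)) {M : ℕ} (hM : 1 ≤ M) :
    Function.Injective (galoisCohomology.res (A.torsionGaloisModule ((2 ^ M : ℕ) : ℤ))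
      (A.divisionField (2 ^ M)) 1) :=
  res_injective_divisionField_twoPow_rat_of_cube_ne (rat_cube_ne_3888_mul_pow_four hp hp2) A hA hM

/-- Route-binder form (`p ≡ 4, 7 (mod 9)` prime, the HSY class 𝒞_HSY): both curves of the pair
`(B ≅ E_p, A ≅ E_{3p²})` over `ℚ` have injective `res` at every level `2^M`, `M ≥ 1`.
[cite: McCallumLMS1991, Prop. 2.1] -/
theorem res_injective_divisionField_twoPow_pair {p : ℕ} (hp : p.Prime)
    (h9 : p % 9 = 4 ∨ p % 9 = 7) (A B : WeierstrassCurve ℚ) [A.IsElliptic] [B.IsElliptic]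
    (hB : ∃ C : VariableChange ℚ, C • B = cubeSumCurve (p : ℚ))
    (hA : ∃ C : VariableChange ℚ, C • A = cubeSumCurve (3 * (p : ℚ) ^ 2)) {M : ℕ} (hM : 1 ≤ M) :
    Function.Injective (galoisCohomology.res (B.torsionGaloisModule ((2 ^ M : ℕ) : ℤ))
        (B.divisionField (2 ^ M)) 1) ∧
      Function.Injective (galoisCohomology.res (A.torsionGaloisModule ((2 ^ M : ℕ) : ℤ))
        (A.divisionField (2 ^ M)) 1) :=
  ⟨res_injective_divisionField_twoPow_rat hp (SylvesterTwoLower.ne_two_of_mod_nine h9) B hB hM,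
    res_injective_divisionField_twoPow_rat_partner hp (SylvesterTwoLower.ne_two_of_mod_nine h9) A hA hM⟩

end Rat

/-! ## §3 Over a quadratic number field `K` (the Heegner fields) -/

section Quadratic

variable (K : Type) [Field K] [NumberField K]

/-- **`H¹(K, E[2^M]) → H¹(K(E[2^M]), E[2^M])` is injective for every `K`-model of the base change
of `cubeSumCurve n` to a QUADRATIC number field `K`, when `432n²` is not a rational cube** (a
rational non-cube has no cube root in `K`). [folklore] -/
theorem res_injective_divisionField_twoPow_quadratic_of_cube_ne (hK : Module.finrank ℚ K = 2)
    {n : ℚ} (hn0 : n ≠ 0) (hn : ∀ q : ℚ, q ^ 3 ≠ 432 * n ^ 2)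
    (B : WeierstrassCurve K) [B.IsElliptic]
    (hB : ∃ C : VariableChange K, C • B = (cubeSumCurve n).baseChange K) {M : ℕ} (hM : 1 ≤ M) :
    Function.Injective (galoisCohomology.res (B.torsionGaloisModule ((2 ^ M : ℕ) : ℤ))
      (B.divisionField (2 ^ M)) 1) := by
  obtain ⟨C, hCB⟩ := hB
  have hc : ∀ x : K, x ^ 3 ≠ algebraMap ℚ K (432 * n ^ 2) :=
    cube_ne_algebraMap_of_finrank_eq_two K hK (mul_ne_zero (by norm_num) (pow_ne_zero 2 hn0)) hn
  refine res_injective_divisionField_twoPow_of_mordell hc B (C := C) ?_ hM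
  rw [hCB]
  ext <;> simp [cubeSumCurve, WeierstrassCurve.baseChange]

/-- **McCallum's Prop. 2.1 at `p = 2` over a quadratic field for `E_p`**: `K` a quadratic number
field (e.g. an imaginary quadratic Heegner field), `p` an odd prime, `B` any `K`-model of
`E_p ×_ℚ K`, `M ≥ 1`. [cite: McCallumLMS1991, Prop. 2.1] -/
theorem res_injective_divisionField_twoPow_quadratic {p : ℕ} (hp : p.Prime) (hp2 : p ≠ 2)
    (hK : Module.finrank ℚ K = 2) (B : WeierstrassCurve K) [B.IsElliptic]
    (hB : ∃ C : VariableChange K, C • B = (cubeSumCurve (p : ℚ)).baseChange K) {M : ℕ}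
    (hM : 1 ≤ M) :
    Function.Injective (galoisCohomology.res (B.torsionGaloisModule ((2 ^ M : ℕ) : ℤ))
      (B.divisionField (2 ^ M)) 1) :=
  res_injective_divisionField_twoPow_quadratic_of_cube_ne K hK (Nat.cast_ne_zero.mpr hp.ne_zero)
    (SylvesterTwoFrame.rat_cube_ne_432_mul_sq hp hp2) B hB hM

/-- **The same over a quadratic field for the partner `E_{3p²}`.** [cite: McCallumLMS1991, Prop. 2.1] -/
theorem res_injective_divisionField_twoPow_quadratic_partner {p : ℕ} (hp : p.Prime) (hp2 : p ≠ 2)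
    (hK : Module.finrank ℚ K = 2) (A : WeierstrassCurve K) [A.IsElliptic]
    (hA : ∃ C : VariableChange K, C • A = (cubeSumCurve (3 * (p : ℚ) ^ 2)).baseChange K) {M : ℕ}
    (hM : 1 ≤ M) :
    Function.Injective (galoisCohomology.res (A.torsionGaloisModule ((2 ^ M : ℕ) : ℤ))
      (A.divisionField (2 ^ M)) 1) :=
  res_injective_divisionField_twoPow_quadratic_of_cube_ne K hK
    (mul_ne_zero (by norm_num) (pow_ne_zero 2 (Nat.cast_ne_zero.mpr hp.ne_zero)))
    (rat_cube_ne_3888_mul_pow_four hp hp2) A hA hM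

/-- In particular over the IMAGINARY QUADRATIC fields of the route (`IsImaginaryQuadratic K`):
both curves of the pair, every `K`-model, every `M ≥ 1`. [cite: McCallumLMS1991, Prop. 2.1] -/
theorem res_injective_divisionField_twoPow_pair_imaginaryQuadratic {p : ℕ} (hp : p.Prime)
    (h9 : p % 9 = 4 ∨ p % 9 = 7) (hK : IsImaginaryQuadratic K)
    (A B : WeierstrassCurve K) [A.IsElliptic] [B.IsElliptic]
    (hB : ∃ C : VariableChange K, C • B = (cubeSumCurve (p : ℚ)).baseChange K)
    (hA : ∃ C : VariableChange K, C • A = (cubeSumCurve (3 * (p : ℚ) ^ 2)).baseChange K)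
    {M : ℕ} (hM : 1 ≤ M) :
    Function.Injective (galoisCohomology.res (B.torsionGaloisModule ((2 ^ M : ℕ) : ℤ))
        (B.divisionField (2 ^ M)) 1) ∧
      Function.Injective (galoisCohomology.res (A.torsionGaloisModule ((2 ^ M : ℕ) : ℤ))
        (A.divisionField (2 ^ M)) 1) :=
  ⟨res_injective_divisionField_twoPow_quadratic K hp (SylvesterTwoLower.ne_two_of_mod_nine h9) hK.1 B hB hM,
    res_injective_divisionField_twoPow_quadratic_partner K hp (SylvesterTwoLower.ne_two_of_mod_nine h9) hK.1 A hA hM⟩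

end Quadratic

end Summit.BirchSwinnertonDyer.BirchSwinnertonDyer.Theorems.SylvesterTwoUpper

end
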